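import Summits.Ventures.Crystal3D.Theorems.StickyWulffConstantPolycrystalWulffBoundFibreChimera

/-!
# Chimera Brunn–Minkowski with a POINT-DEPENDENT summand drawn from finitely many bodies whose fibres
# are TRANSLATES of one reference fibre (engine for the general single-axis rung of
# `PolycrystalWulffBound`, line `PolyDensity`, crux `stmt-Ventures-19482`)

Route `StickyWulffConstant` of the venture `Summits/Ventures/Crystal3D`, second prover lane (poly-p2,
gen 10).  The fibre engine `chimera3_fibre_brunnMinkowski` (`…FibreChimera`, gen 8) lets the summand
depend on the HEIGHT `a 2` and the ABSCISSA `a 0` of the point `a ∈ A`, so along every fibre line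
(direction = coordinate `1`) one body is used; for twin textures this forces the ZONE condition (grain type
constant along fibre lines).  Here the summand depends on the point `a` itself through a finite family:
`A = ⋃ j, A j` (pairwise disjoint pieces — the grains), body `W j` on `A j`, under two hypotheses:
* FIBRE TRANSLATES: over every base point `(η, u)` the fibre `{y | (η, y, u) ∈ W j}` contains the
  translate by `δ j u η` of the reference fibre `{y | (η, y, u) ∈ W₀}` (for the fcc twin pair about `[111]`
  with the fibre along a horizontal `⟨112⟩` direction `w`: `R_m W = R_w W`, so the twin's fibres are the
  reference fibres reflected in place, i.e. translated by `−(lo + hi)`, `|lo + hi| ≤ 2/√6`);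
* SEPARATION ALONG FIBRES: two points of DIFFERENT pieces on a common fibre line never differ, in the
  fibre coordinate, by exactly the difference of their bodies' offsets (`a 1 − a' 1 ≠ δ j' u η − δ j u η`;
  bought in the application by trimming the grains within fibre-distance `r·2/√6` of a grain of the
  other lattice — this is where the wall charge `(2/√6)|⟪w, ν⟫|` is paid).
Then `|A|^{1/3} + |W₀|^{1/3} ≤ |C|^{1/3}` for every measurable `C ⊇ {a + w | a ∈ A j, w ∈ W j}`:
* `volume_iUnion_translate_fibre` — the one-dimensional bookkeeping (disjoint translates of disjoint
  pieces have the total length of the pieces);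
* `chimera2_multiBody_volume_rpow_mul_le` — planar, multiplicative form (PL on the line over 1-D
  multiplicative Brunn–Minkowski applied to the SLID fibre `⋃ j, (F j + (s/(1−s))·δ j)`);
* `chimera3_multiBody_volume_rpow_mul_le` / `chimera3_multiBody_brunnMinkowski_pow` /
  `chimera3_multiBody_brunnMinkowski` — `Fin 3 → ℝ` (height = coordinate `2`, abscissa = `0`,
  fibre = `1`), multiplicative / homogeneous / root forms.
No zone condition, no runs, no windows: the grains may have ANY shapes.
WHAT THIS IS NOT: anything about lattices or perimeters; the trimming estimate and the rung are separate
files; the crux is not claimed.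
-/

noncomputable section

namespace Summit.Ventures.Crystal3D.Theorems.Chimera

open MeasureTheory Set
open Literature.Analysis.Convexity (prekopaLeindler_real)
open scoped ENNReal Pointwise

/-! ### One-dimensional bookkeeping: disjoint translates of disjoint pieces -/

/-- The translate `{y | y - c ∈ F}` of a measurable set of reals is measurable. -/
theorem measurableSet_translate_real {F : Set ℝ} (hF : MeasurableSet F) (c : ℝ) :
    MeasurableSet ((fun y : ℝ => y - c) ⁻¹' F) :=
  hF.preimage (measurable_id.sub measurable_const)

/-- The translate `{y | y - c ∈ F}` has the length of `F`. -/
theorem volume_translate_real (F : Set ℝ) (c : ℝ) :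
    volume ((fun y : ℝ => y - c) ⁻¹' F) = volume F := by
  have : (fun y : ℝ => y - c) = fun y => y + -c := by funext y; ring
  rw [this, measure_preimage_add_right]

/-- **Disjoint translates of disjoint pieces.**  If the measurable sets `F j` are pairwise disjoint
and their translates `F j + c j` are pairwise disjoint, the union of the translates has the length of
the union of the pieces. -/
theorem volume_iUnion_translate_fibre {N : ℕ} (F : Fin N → Set ℝ) (c : Fin N → ℝ)
    (hF : ∀ j, MeasurableSet (F j)) (hdisj : ∀ j j', j ≠ j' → Disjoint (F j) (F j'))
    (hdisj' : ∀ j j', j ≠ j' →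
      Disjoint ((fun y : ℝ => y - c j) ⁻¹' F j) ((fun y : ℝ => y - c j') ⁻¹' F j')) :
    volume (⋃ j, (fun y : ℝ => y - c j) ⁻¹' F j) = volume (⋃ j, F j) := by
  rw [measure_iUnion (fun j j' hjj' => hdisj' j j' hjj') (fun j => measurableSet_translate_real (hF j) _),
    measure_iUnion (fun j j' hjj' => hdisj j j' hjj') hF]
  exact tsum_congr fun j => volume_translate_real (F j) (c j)

/-! ### Planar multi-body chimera (abscissa = first coordinate, fibre = second) -/

/-- **Planar multi-body chimera Brunn–Minkowski, multiplicative form.**  Pieces `A j ⊆ ℝ × ℝ`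
(pairwise disjoint, measurable) with bodies `K j` whose fibres over every abscissa `η` contain the
translate by `δ j η` of the fibre of the reference body `K₀`; points of different pieces on a common
fibre line satisfy `(1−s)(p₂ − p'₂) ≠ s(δ j' η − δ j η)`; `C ∋ (1−s)p + s q` for `p ∈ A j`, `q ∈ K j`.
Then `|⋃ A j|^{1−s}·|K₀|^s ≤ |C|`. -/
theorem chimera2_multiBody_volume_rpow_mul_le {s : ℝ} (hs0 : 0 < s) (hs1 : s < 1) {N : ℕ}
    (A K : Fin N → Set (ℝ × ℝ)) {K₀ C : Set (ℝ × ℝ)} (δ : Fin N → ℝ → ℝ)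
    (hA : ∀ j, MeasurableSet (A j)) (hC : MeasurableSet C) (hK₀ : MeasurableSet K₀)
    (hdisj : ∀ j j', j ≠ j' → Disjoint (A j) (A j'))
    (hfib : ∀ j η, ∀ y ∈ Prod.mk η ⁻¹' K₀, y + δ j η ∈ Prod.mk η ⁻¹' K j)
    (hsep : ∀ j j', j ≠ j' → ∀ p ∈ A j, ∀ p' ∈ A j', p.1 = p'.1 → ∀ η,
      (1 - s) * (p.2 - p'.2) ≠ s * (δ j' η - δ j η))
    (hsub : ∀ j, ∀ p ∈ A j, ∀ q ∈ K j, (1 - s) • p + s • q ∈ C) :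
    volume (⋃ j, A j) ^ (1 - s) * volume K₀ ^ s ≤ volume C := by
  have h1s : 0 < 1 - s := by linarith
  have hAU : MeasurableSet (⋃ j, A j) := MeasurableSet.iUnion hA
  set φ : ℝ → ℝ≥0∞ := fun ξ => volume (Prod.mk ξ ⁻¹' ⋃ j, A j) with hφ
  set ψ : ℝ → ℝ≥0∞ := fun η => volume (Prod.mk η ⁻¹' K₀) with hψ
  set h : ℝ → ℝ≥0∞ := fun ζ => volume (Prod.mk ζ ⁻¹' C) with hh
  have key : ∀ ξ η, φ ξ ^ (1 - s) * ψ η ^ s ≤ h ((1 - s) • ξ + s • η) := by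
    intro ξ η
    -- the fibres of the pieces over `ξ` and their slid copies
    set F : Fin N → Set ℝ := fun j => Prod.mk ξ ⁻¹' A j with hFdef
    set c : Fin N → ℝ := fun j => s / (1 - s) * δ j η with hcdef
    have hF : ∀ j, MeasurableSet (F j) := fun j => (hA j).preimage measurable_prodMk_left
    have hFdisj : ∀ j j', j ≠ j' → Disjoint (F j) (F j') := by
      intro j j' hjj'
      rw [Set.disjoint_left]
      intro y hy hy'
      exact Set.disjoint_left.1 (hdisj j j' hjj') hy hy'
    have hFdisj' : ∀ j j', j ≠ j' →
        Disjoint ((fun y : ℝ => y - c j) ⁻¹' F j) ((fun y : ℝ => y - c j') ⁻¹' F j') := by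
      intro j j' hjj'
      rw [Set.disjoint_left]
      intro y hy hy'
      have hp : (ξ, y - c j) ∈ A j := hy
      have hp' : (ξ, y - c j') ∈ A j' := hy'
      have hne := hsep j j' hjj' (ξ, y - c j) hp (ξ, y - c j') hp' rfl η
      apply hne
      show (1 - s) * ((y - c j) - (y - c j')) = s * (δ j' η - δ j η)
      rw [hcdef]
      field_simp
      ring
    set Y : Set ℝ := ⋃ j, (fun y : ℝ => y - c j) ⁻¹' F j with hYdef
    have hYm : MeasurableSet Y := MeasurableSet.iUnion fun j => measurableSet_translate_real (hF j) _
    have hYvol : volume Y = φ ξ := by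
      rw [hYdef, volume_iUnion_translate_fibre F c hF hFdisj hFdisj', hφ]
      congr 1
      ext y
      simp only [hFdef, mem_iUnion, mem_preimage]
    -- the slid fibre plus the reference fibre lands in the fibre of `C`
    have hincl : (1 - s) • Y + s • (Prod.mk η ⁻¹' K₀) ⊆ Prod.mk ((1 - s) • ξ + s • η) ⁻¹' C := by
      intro z hz
      obtain ⟨_, ⟨y, hy, rfl⟩, _, ⟨y₂, hy₂, rfl⟩, rfl⟩ := hz
      obtain ⟨j, hyj⟩ := mem_iUnion.1 hy
      have hp : (ξ, y - c j) ∈ A j := hyj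
      have hq : (η, y₂ + δ j η) ∈ K j := hfib j η y₂ hy₂
      have h1 := hsub j (ξ, y - c j) hp (η, y₂ + δ j η) hq
      have e2 : (1 - s) * (y - c j) + s * (y₂ + δ j η) = (1 - s) * y + s * y₂ := by
        rw [hcdef]
        field_simp
        ring
      have e : ((1 - s) • ((ξ, y - c j) : ℝ × ℝ) + s • ((η, y₂ + δ j η) : ℝ × ℝ)) =
          ((1 - s) * ξ + s * η, (1 - s) * y + s * y₂) := by
        ext
        · simp [smul_eq_mul]
        · simp only [Prod.snd_add, Prod.smul_snd, smul_eq_mul, e2]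
      rw [e] at h1
      simpa [smul_eq_mul] using h1
    calc φ ξ ^ (1 - s) * ψ η ^ s = volume Y ^ (1 - s) * volume (Prod.mk η ⁻¹' K₀) ^ s := by
          rw [hYvol]
      _ ≤ h ((1 - s) • ξ + s • η) :=
          volume_rpow_mul_volume_rpow_le_real1 hs0 hs1 hYm (hK₀.preimage measurable_prodMk_left)
            (hC.preimage measurable_prodMk_left) hincl
  have pl := prekopaLeindler_real hs0 hs1 (measurable_volume_fibre2 hAU) (measurable_volume_fibre2 hK₀)
    (measurable_volume_fibre2 hC) key
  rw [volume_eq_lintegral_fibre2 _ hAU, volume_eq_lintegral_fibre2 K₀ hK₀, volume_eq_lintegral_fibre2 C hC]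
  exact pl

/-! ### Multi-body chimera in `Fin 3 → ℝ` (height `2`, abscissa `0`, fibre `1`) -/

/-- **Multi-body chimera Brunn–Minkowski, multiplicative form** (`Fin 3 → ℝ`; height = coordinate `2`,
abscissa = coordinate `0`, fibre = coordinate `1`): pieces `A j` (pairwise disjoint) with bodies `W j`
whose fibres over every base point `(η, u)` contain the translate by `δ j u η` of the fibre of `W₀`;
points of different pieces on a common fibre line satisfy `(1−s)(a 1 − a' 1) ≠ s(δ j' u η − δ j u η)`;
`C ∋ (1−s)a + s w` for `a ∈ A j`, `w ∈ W j`.  Then `|⋃ A j|^{1−s}|W₀|^s ≤ |C|`. -/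
theorem chimera3_multiBody_volume_rpow_mul_le {s : ℝ} (hs0 : 0 < s) (hs1 : s < 1) {N : ℕ}
    (A W : Fin N → Set (Fin 3 → ℝ)) {W₀ C : Set (Fin 3 → ℝ)} (δ : Fin N → ℝ → ℝ → ℝ)
    (hA : ∀ j, MeasurableSet (A j)) (hC : MeasurableSet C) (hW₀ : MeasurableSet W₀)
    (hdisj : ∀ j j', j ≠ j' → Disjoint (A j) (A j'))
    (hfib : ∀ j u η, ∀ y ∈ {y : ℝ | (![η, y, u] : Fin 3 → ℝ) ∈ W₀},
      y + δ j u η ∈ {y : ℝ | (![η, y, u] : Fin 3 → ℝ) ∈ W j})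
    (hsep : ∀ j j', j ≠ j' → ∀ a ∈ A j, ∀ a' ∈ A j', a 0 = a' 0 → a 2 = a' 2 → ∀ u η,
      (1 - s) * (a 1 - a' 1) ≠ s * (δ j' u η - δ j u η))
    (hsub : ∀ j, ∀ a ∈ A j, ∀ w ∈ W j, (1 - s) • a + s • w ∈ C) :
    volume (⋃ j, A j) ^ (1 - s) * volume W₀ ^ s ≤ volume C := by
  have hAU : MeasurableSet (⋃ j, A j) := MeasurableSet.iUnion hA
  set φ : ℝ → ℝ≥0∞ := fun t => volume {p : ℝ × ℝ | (![p.1, p.2, t] : Fin 3 → ℝ) ∈ ⋃ j, A j} with hφ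
  set ψ : ℝ → ℝ≥0∞ := fun u => volume {p : ℝ × ℝ | (![p.1, p.2, u] : Fin 3 → ℝ) ∈ W₀} with hψ
  set h : ℝ → ℝ≥0∞ := fun z => volume {p : ℝ × ℝ | (![p.1, p.2, z] : Fin 3 → ℝ) ∈ C} with hh
  have key : ∀ t u, φ t ^ (1 - s) * ψ u ^ s ≤ h ((1 - s) • t + s • u) := by
    intro t u
    have hslice : {p : ℝ × ℝ | (![p.1, p.2, t] : Fin 3 → ℝ) ∈ ⋃ j, A j} =
        ⋃ j, {p : ℝ × ℝ | (![p.1, p.2, t] : Fin 3 → ℝ) ∈ A j} := by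
      ext p; simp
    have h2 := chimera2_multiBody_volume_rpow_mul_le hs0 hs1
      (fun j => {p : ℝ × ℝ | (![p.1, p.2, t] : Fin 3 → ℝ) ∈ A j})
      (fun j => {p : ℝ × ℝ | (![p.1, p.2, u] : Fin 3 → ℝ) ∈ W j})
      (K₀ := {p : ℝ × ℝ | (![p.1, p.2, u] : Fin 3 → ℝ) ∈ W₀})
      (C := {p : ℝ × ℝ | (![p.1, p.2, (1 - s) • t + s • u] : Fin 3 → ℝ) ∈ C})
      (fun j η => δ j u η)
      (fun j => measurableSet_slice3 (hA j) t) (measurableSet_slice3 hC _) (measurableSet_slice3 hW₀ u)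
      (by
        intro j j' hjj'
        rw [Set.disjoint_left]
        intro p hp hp'
        exact Set.disjoint_left.1 (hdisj j j' hjj') hp hp')
      (by
        intro j η y hy
        have hy' : (![η, y, u] : Fin 3 → ℝ) ∈ W₀ := by simpa using hy
        have := hfib j u η y hy'
        simpa using this)
      (by
        rintro j j' hjj' p hp p' hp' hpp' η
        have ha : (![p.1, p.2, t] : Fin 3 → ℝ) ∈ A j := by simpa using hp
        have ha' : (![p'.1, p'.2, t] : Fin 3 → ℝ) ∈ A j' := by simpa using hp'
        have := hsep j j' hjj' _ ha _ ha' (by simp [hpp']) (by simp) u η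
        simpa using this)
      (by
        rintro j p hp q hq
        have ha : (![p.1, p.2, t] : Fin 3 → ℝ) ∈ A j := by simpa using hp
        have hw : (![q.1, q.2, u] : Fin 3 → ℝ) ∈ W j := by simpa using hq
        have h1 := hsub j _ ha _ hw
        have e : (1 - s) • (![p.1, p.2, t] : Fin 3 → ℝ) + s • (![q.1, q.2, u] : Fin 3 → ℝ) =
            ![((1 - s) • p + s • q).1, ((1 - s) • p + s • q).2, (1 - s) • t + s • u] := by
          ext i; fin_cases i <;> simp [smul_eq_mul]
        rw [e] at h1
        exact h1)
    show volume {p : ℝ × ℝ | (![p.1, p.2, t] : Fin 3 → ℝ) ∈ ⋃ j, A j} ^ (1 - s) *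
        volume {p : ℝ × ℝ | (![p.1, p.2, u] : Fin 3 → ℝ) ∈ W₀} ^ s ≤
      volume {p : ℝ × ℝ | (![p.1, p.2, (1 - s) • t + s • u] : Fin 3 → ℝ) ∈ C}
    rw [hslice]
    exact h2
  have pl := prekopaLeindler_real hs0 hs1 (measurable_volume_slice3 hAU)
    (measurable_volume_slice3 hW₀) (measurable_volume_slice3 hC) key
  rw [volume_eq_lintegral_slice3 _ hAU, volume_eq_lintegral_slice3 W₀ hW₀, volume_eq_lintegral_slice3 C hC]
  exact pl

/-- **Multi-body chimera Brunn–Minkowski, additive (homogeneous) form**: pieces `A j`, bodies `W j`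
with fibre translates of `W₀` (offsets `δ j u η`), fibre separation `a 1 − a' 1 ≠ δ j' u η − δ j u η`
for points of different pieces on a common fibre line (for ALL base points `(η, u)`),
`C ⊇ {a + w | a ∈ A j, w ∈ W j}`, `a³ ≤ |⋃ A j|`, `b³ ≤ |W₀|` (`a, b > 0`): `(a + b)³ ≤ |C|`. -/
theorem chimera3_multiBody_brunnMinkowski_pow {N : ℕ}
    (A W : Fin N → Set (Fin 3 → ℝ)) {W₀ C : Set (Fin 3 → ℝ)} (δ : Fin N → ℝ → ℝ → ℝ)
    (hA : ∀ j, MeasurableSet (A j)) (hC : MeasurableSet C) (hW₀ : MeasurableSet W₀)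
    (hdisj : ∀ j j', j ≠ j' → Disjoint (A j) (A j'))
    (hfib : ∀ j u η, ∀ y ∈ {y : ℝ | (![η, y, u] : Fin 3 → ℝ) ∈ W₀},
      y + δ j u η ∈ {y : ℝ | (![η, y, u] : Fin 3 → ℝ) ∈ W j})
    (hsep : ∀ j j', j ≠ j' → ∀ a ∈ A j, ∀ a' ∈ A j', a 0 = a' 0 → a 2 = a' 2 → ∀ u η,
      a 1 - a' 1 ≠ δ j' u η - δ j u η)
    (hsub : ∀ j, ∀ a ∈ A j, ∀ w ∈ W j, a + w ∈ C)
    {a b : ℝ} (ha : 0 < a) (hb : 0 < b) (hvA : ENNReal.ofReal (a ^ 3) ≤ volume (⋃ j, A j))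
    (hvB : ENNReal.ofReal (b ^ 3) ≤ volume W₀) :
    ENNReal.ofReal ((a + b) ^ 3) ≤ volume C := by
  have hab : 0 < a + b := add_pos ha hb
  set s : ℝ := b / (a + b) with hs
  have hs0 : 0 < s := div_pos hb hab
  have hs1 : s < 1 := (div_lt_one hab).2 (by linarith)
  have h1s : 1 - s = a / (a + b) := by rw [hs]; field_simp; ring
  have hvA' : 1 ≤ volume (⋃ j, a⁻¹ • A j) := by
    rw [← Set.smul_set_iUnion, volume_smul_fin3, abs_of_pos (inv_pos.2 ha)]
    calc (1 : ℝ≥0∞) = ENNReal.ofReal (a⁻¹ ^ 3) * ENNReal.ofReal (a ^ 3) := by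
          rw [← ENNReal.ofReal_mul (pow_nonneg (inv_pos.2 ha).le _), ← mul_pow,
            inv_mul_cancel₀ ha.ne', one_pow, ENNReal.ofReal_one]
      _ ≤ ENNReal.ofReal (a⁻¹ ^ 3) * volume (⋃ j, A j) := by gcongr
  have hvB' : 1 ≤ volume (b⁻¹ • W₀) := by
    rw [volume_smul_fin3, abs_of_pos (inv_pos.2 hb)]
    calc (1 : ℝ≥0∞) = ENNReal.ofReal (b⁻¹ ^ 3) * ENNReal.ofReal (b ^ 3) := by
          rw [← ENNReal.ofReal_mul (pow_nonneg (inv_pos.2 hb).le _), ← mul_pow,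
            inv_mul_cancel₀ hb.ne', one_pow, ENNReal.ofReal_one]
      _ ≤ ENNReal.ofReal (b⁻¹ ^ 3) * volume W₀ := by gcongr
  -- scaled offsets
  set δ' : Fin N → ℝ → ℝ → ℝ := fun j u η => b⁻¹ * δ j (b * u) (b * η) with hδ'
  have hfib' : ∀ j u η, ∀ y ∈ {y : ℝ | (![η, y, u] : Fin 3 → ℝ) ∈ b⁻¹ • W₀},
      y + δ' j u η ∈ {y : ℝ | (![η, y, u] : Fin 3 → ℝ) ∈ b⁻¹ • W j} := by
    intro j u η y hy
    rw [mem_setOf_eq, Set.mem_smul_set_iff_inv_smul_mem₀ (inv_ne_zero hb.ne'), inv_inv] at hy ⊢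
    have e1 : b • (![η, y, u] : Fin 3 → ℝ) = ![b * η, b * y, b * u] := by
      ext i; fin_cases i <;> simp [smul_eq_mul]
    have e2 : b • (![η, y + δ' j u η, u] : Fin 3 → ℝ) =
        ![b * η, b * y + δ j (b * u) (b * η), b * u] := by
      ext i; fin_cases i <;> simp [smul_eq_mul, hδ']
      rw [mul_add, ← mul_assoc, mul_inv_cancel₀ hb.ne', one_mul]
    rw [e1] at hy
    rw [e2]
    exact hfib j (b * u) (b * η) (b * y) hy
  have hsep' : ∀ j j', j ≠ j' → ∀ x ∈ a⁻¹ • A j, ∀ x' ∈ a⁻¹ • A j', x 0 = x' 0 → x 2 = x' 2 →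
      ∀ u η, (1 - s) * (x 1 - x' 1) ≠ s * (δ' j' u η - δ' j u η) := by
    intro j j' hjj' x hx x' hx' h0 h2 u η
    obtain ⟨y, hy, rfl⟩ := Set.mem_smul_set.1 hx
    obtain ⟨y', hy', rfl⟩ := Set.mem_smul_set.1 hx'
    have h0' : y 0 = y' 0 := by
      have := h0; simp only [Pi.smul_apply, smul_eq_mul] at this
      exact mul_left_cancel₀ (inv_ne_zero ha.ne') this
    have h2' : y 2 = y' 2 := by
      have := h2; simp only [Pi.smul_apply, smul_eq_mul] at this
      exact mul_left_cancel₀ (inv_ne_zero ha.ne') this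
    have hne := hsep j j' hjj' y hy y' hy' h0' h2' (b * u) (b * η)
    intro heq
    apply hne
    simp only [Pi.smul_apply, smul_eq_mul, hδ'] at heq
    rw [h1s, hs] at heq
    field_simp at heq
    linarith
  have hsub' : ∀ j, ∀ x ∈ a⁻¹ • A j, ∀ w' ∈ b⁻¹ • W j, (1 - s) • x + s • w' ∈ (a + b)⁻¹ • C := by
    intro j x hx w' hw'
    obtain ⟨y, hy, rfl⟩ := Set.mem_smul_set.1 hx
    obtain ⟨z, hz, rfl⟩ := Set.mem_smul_set.1 hw'
    refine Set.mem_smul_set.2 ⟨y + z, hsub j y hy z hz, ?_⟩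
    rw [h1s, hs, smul_smul, smul_smul, div_mul_eq_mul_div, mul_inv_cancel₀ ha.ne',
      div_mul_eq_mul_div, mul_inv_cancel₀ hb.ne', one_div, smul_add]
  have hdisj' : ∀ j j', j ≠ j' → Disjoint (a⁻¹ • A j) (a⁻¹ • A j') := by
    intro j j' hjj'
    rw [Set.disjoint_left]
    intro x hx hx'
    rw [Set.mem_smul_set_iff_inv_smul_mem₀ (inv_ne_zero ha.ne')] at hx hx'
    exact Set.disjoint_left.1 (hdisj j j' hjj') hx hx'
  have hmult := chimera3_multiBody_volume_rpow_mul_le hs0 hs1 (fun j => a⁻¹ • A j) (fun j => b⁻¹ • W j)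
    δ' (fun j => (hA j).const_smul₀ a⁻¹) (hC.const_smul₀ (a + b)⁻¹) (hW₀.const_smul₀ b⁻¹)
    hdisj' hfib' hsep' hsub'
  have hone : (1 : ℝ≥0∞) ≤ volume ((a + b)⁻¹ • C) := by
    calc (1 : ℝ≥0∞) = 1 ^ (1 - s) * 1 ^ s := by rw [ENNReal.one_rpow, ENNReal.one_rpow, one_mul]
      _ ≤ volume (⋃ j, a⁻¹ • A j) ^ (1 - s) * volume (b⁻¹ • W₀) ^ s :=
          mul_le_mul' (ENNReal.rpow_le_rpow hvA' (by linarith)) (ENNReal.rpow_le_rpow hvB' hs0.le)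
      _ ≤ volume ((a + b)⁻¹ • C) := hmult
  rw [volume_smul_fin3, abs_of_pos (inv_pos.2 hab)] at hone
  calc ENNReal.ofReal ((a + b) ^ 3) = ENNReal.ofReal ((a + b) ^ 3) * 1 := (mul_one _).symm
    _ ≤ ENNReal.ofReal ((a + b) ^ 3) * (ENNReal.ofReal ((a + b)⁻¹ ^ 3) * volume C) := by gcongr
    _ = volume C := by
        rw [← mul_assoc, ← ENNReal.ofReal_mul (pow_nonneg hab.le _), ← mul_pow,
          mul_inv_cancel₀ hab.ne', one_pow, ENNReal.ofReal_one, one_mul]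

/-- **Multi-body chimera Brunn–Minkowski, root form**: `|⋃ A j|^{1/3} + |W₀|^{1/3} ≤ |C|^{1/3}` for
`0 < |⋃ A j| < ∞`, `0 < |W₀| < ∞`, under fibre translates, fibre separation and
`C ⊇ {a + w | a ∈ A j, w ∈ W j}`. -/
theorem chimera3_multiBody_brunnMinkowski {N : ℕ}
    (A W : Fin N → Set (Fin 3 → ℝ)) {W₀ C : Set (Fin 3 → ℝ)} (δ : Fin N → ℝ → ℝ → ℝ)
    (hA : ∀ j, MeasurableSet (A j)) (hC : MeasurableSet C) (hW₀ : MeasurableSet W₀)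
    (hdisj : ∀ j j', j ≠ j' → Disjoint (A j) (A j'))
    (hfib : ∀ j u η, ∀ y ∈ {y : ℝ | (![η, y, u] : Fin 3 → ℝ) ∈ W₀},
      y + δ j u η ∈ {y : ℝ | (![η, y, u] : Fin 3 → ℝ) ∈ W j})
    (hsep : ∀ j j', j ≠ j' → ∀ a ∈ A j, ∀ a' ∈ A j', a 0 = a' 0 → a 2 = a' 2 → ∀ u η,
      a 1 - a' 1 ≠ δ j' u η - δ j u η)
    (hsub : ∀ j, ∀ a ∈ A j, ∀ w ∈ W j, a + w ∈ C)
    (hA0 : volume (⋃ j, A j) ≠ 0) (hAt : volume (⋃ j, A j) ≠ ⊤)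
    (hB0 : volume W₀ ≠ 0) (hBt : volume W₀ ≠ ⊤) :
    volume (⋃ j, A j) ^ ((3 : ℕ)⁻¹ : ℝ) + volume W₀ ^ ((3 : ℕ)⁻¹ : ℝ) ≤ volume C ^ ((3 : ℕ)⁻¹ : ℝ) := by
  have hn : (3 : ℕ) ≠ 0 := by norm_num
  have hn0 : (0 : ℝ) < ((3 : ℕ)⁻¹ : ℝ) := by positivity
  set a : ℝ := (volume (⋃ j, A j)).toReal ^ ((3 : ℕ)⁻¹ : ℝ) with ha_def
  set b : ℝ := (volume W₀).toReal ^ ((3 : ℕ)⁻¹ : ℝ) with hb_def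
  have ha : 0 < a := Real.rpow_pos_of_pos (ENNReal.toReal_pos hA0 hAt) _
  have hb : 0 < b := Real.rpow_pos_of_pos (ENNReal.toReal_pos hB0 hBt) _
  have han : ENNReal.ofReal (a ^ 3) = volume (⋃ j, A j) := by
    rw [ha_def, Real.rpow_inv_natCast_pow ENNReal.toReal_nonneg hn, ENNReal.ofReal_toReal hAt]
  have hbn : ENNReal.ofReal (b ^ 3) = volume W₀ := by
    rw [hb_def, Real.rpow_inv_natCast_pow ENNReal.toReal_nonneg hn, ENNReal.ofReal_toReal hBt]
  have hpow := chimera3_multiBody_brunnMinkowski_pow A W δ hA hC hW₀ hdisj hfib hsep hsub ha hb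
    han.le hbn.le
  have hroot := ENNReal.rpow_le_rpow hpow hn0.le
  rw [ENNReal.ofReal_rpow_of_nonneg (pow_nonneg (add_nonneg ha.le hb.le) _) hn0.le,
    Real.pow_rpow_inv_natCast (add_nonneg ha.le hb.le) hn, ENNReal.ofReal_add ha.le hb.le] at hroot
  have hA' : ENNReal.ofReal a = volume (⋃ j, A j) ^ ((3 : ℕ)⁻¹ : ℝ) := by
    rw [ha_def, ← ENNReal.ofReal_rpow_of_nonneg ENNReal.toReal_nonneg hn0.le,
      ENNReal.ofReal_toReal hAt]
  have hB' : ENNReal.ofReal b = volume W₀ ^ ((3 : ℕ)⁻¹ : ℝ) := by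
    rw [hb_def, ← ENNReal.ofReal_rpow_of_nonneg ENNReal.toReal_nonneg hn0.le,
      ENNReal.ofReal_toReal hBt]
  rwa [hA', hB'] at hroot

end Summit.Ventures.Crystal3D.Theorems.Chimera

end
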